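import Summits.QuantumFields.BalabanUV.Beta.FP.PerfectColumnMassFibre
import Literature.MathematicalPhysics.QuantumFieldTheory.Balaban1983to89.B4Green244
import Literature.MathematicalPhysics.QuantumFieldTheory.Balaban1983to89.Beta.LatticeConstantZl

/-!
# `BalabanUV.Beta.FP.PerfectColumnMass` — road «FP» for binder row D1, row **N7/IPROF-UNIF**, route (γ) part 2: THE PERFECT MINIMISER COLUMN HAS EXPONENTIALLY WEIGHTED
# `ℓ¹` MASS `O(1∕Lc^m)` — `Σ'_x exp((κ∕8)·|x|₁∕Lc^m)·|colOf (KPerf Lc (sfStep Lc) (smStep 3 Lc) m) κ′ l x| ≤ cMass κ·((Lc:ℝ)^m)⁻¹` for every `m ≥ 1`, ONE `κ`, `cMass κ` DISPLAYED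
# and `m`-free («p = 5 in ℓ¹-mean»: the letters of H3-BOOK — mass `O(L⁻¹)`, first moments `O(1)`, second moments `O(L)`, `L = Lc^m` — follow; the sup itself stays at p229339's `p = 1`)

NOT IN PRINT; OUR BOOKKEEPING over road P1's fibre theorems and pv17's Paley–Wiener step, BY NAME.  HONEST FRAMING (cell contract, verbatim): «discharging `BetaPertH` makes
Bałaban's UV stability UNCONDITIONAL — a real constructive-QFT result; it is NOT the continuum limit and NOT the Clay problem.»  HONEST DEPENDENCY (verbatim): «continuum YM on
T⁴ ⇐ BetaPertH ∧ nine spine estimates (0/9 proved); BetaPertH ⇐ (D1) ∧ (D4) ∧ CAP+tail; G-an2-4 gates asym, D1 and NE2/3/4.»  THIS MODULE DISCHARGES NOTHING of N7 ∕ `hasym` ∕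
H4-ASM ∕ row D1 by itself: it supplies the profile LETTERS the owner's H3-BOOK ∕ H4-ASM take as hypotheses, for the perfect minimiser columns, with the powers of `L` those
hypotheses display; the sup-norm power `p = 5` of the row's literal wording is NOT proved (route (α), gan24-p3's alias analysis, stays open).  Cross-lane filing by an idle G-an2-4
swarm seat (unit `b2b-balaban-gan24-formalise-leaf-04`, gen 38) on the owner's row (`HOME/b2b-balaban-beta-d1-p3/LEAVES-FP.md`).  NEVER «G-an2-4 closed»; NOT D1, NOT BetaPertH,
NOT continuum, NOT Clay.

THE ROUTE (γ) (located in the journal 2026-08-20T18:25Z; numbers, not adjectives).  Part 1 (`FP/PerfectColumnMassFibre.stripRegular_fm_uniform_box`) gives ONE `κ` and, for every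
`m j zy κ′ l`, the SUM over the `(Lc^m)⁴` reading representatives `zx` of the strip sup of the re-based fibre functions: `Σ_{zx} ‖kFibΔM … (repZ zx) … p‖ ≤ C_m =
(5 + 2·aR 4)·e^{4κ}·5400·(Lc^m)⁻¹` on `Strip 4 κ`.  §1 (the ε-TRICK) turns a JOINT strip bound of a finite family into a joint bound of the lattice kernels WITHOUT an `ℓ²`
Paley–Wiener: `Σ_i ‖K[f_i](X)‖ = ‖K[Σ_i ε_i f_i](X)‖ ≤ (sup_strip Σ_i ‖f_i‖)·e^{−κ|X|∞}` for unimodular `ε_i` chosen after `X` (pv17's `latticeKernel_decay` on the combination,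
`B4Green244.latticeKernel_sum_mul`).  §2 reads the (j, m)-resolvent's column on the box `x′ = repZ zx + Lc^m•X` (`FibreStripJM.unitK_KTot_eq_offset`, `quo_add_zsmul`, `proj_add_zsmul`)
and sums the box: `Σ_{zx} |unitK … (repZ zx + Lc^m•X) y′ (inl κ′) (inr l)| ≤ C_m·e^{−κ|X − quo y′|∞}`; §3 trades `e^{−κ|·|∞}` for the weight `e^{(κ∕8)|x′−y′|₁∕Lc^m}` (`l1_sub_le_coarse`,
`exp_supNorm_le_exp_l1`) and sums `X` against `Zl 4 (κ∕8) ≤ (1 + 16∕κ)⁴`, for EVERY finite set of fine points (the box decomposition is a bijection; `eq_repZ_add_zsmul_quo`):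
**`sum_weight_abs_unitK_KTot_le`**, `j`-UNIFORM.  §4 passes to `KPerf` on finite sets (`RealRateKMHolds.tendsto_KTot_KPerf_holds`) and to `tsum` (`Real.tsum_le_of_sum_le`); §5 is the
column form **`tsum_weight_abs_colOf_KPerf_le`** and **`expL1_colOf_KPerf`** = the hypotheses `hwE`∕`hwEb` of the consumer's letters interface
`FP/HorizontalBookkeepingTailLetters.summable_weight_transport_tail_sub_of_expL1` (d1-formalise-leaf-02 g6, p231759) at `N := Lc^m`, verbatim shape.
TRUTH CHECK: natural-units column `O(1)` on `|x| ≲ L` × adopted-unit factor `L⁻⁵` (`TransportInfinityM.constReproSum_wStepM`): `ℓ¹ ≍ L⁻¹`, first moment `≍ 1`, second `≍ L` — (γ) is sharp in `ℓ¹`.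

ABSOLUTE RULE (cell, verbatim): «No internally-minted statement may enter as a cited fact. Every hypothesis is either kernel-proved in this package or a verbatim quotation of a PUBLISHED
theorem with page reference.»  Nothing is cited; ONE displayed constant def (`cMass`), no `def … : Prop`, no wall binder instantiated at a value, 0 sorry.
-/

noncomputable section

open Complex Finset Filter Topology
open scoped Real BigOperators ComplexConjugate
open Literature.MathematicalPhysics.QuantumFieldTheory
open Literature.MathematicalPhysics.QuantumFieldTheory.Balaban1983to89
open Literature.MathematicalPhysics.QuantumFieldTheory.Balaban1983to89.Beta
open Literature.MathematicalPhysics.QuantumFieldTheory.LatticeForm (quo repZ proj_repZ proj_add_zsmul)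
open Literature.Probability.LatticeModels (TorusSite Torus.proj)
open B12Sec2to5 (l1 l1_nonneg)
open B4Strip (Strip ofRealVec)
open B4ContourShift (BZ StripRegular latticeKernel latticeKernel_decay supNorm supNorm_nonneg integrand)
open B4Green244 (latticeKernel_sum_mul)
open BlochFibreMatrix (eq_repZ_add_zsmul_quo)
open BlochFibreUniqueness (quo_add_zsmul quo_repZ)
open FibreInverseDecay (exp_supNorm_le_exp_l1)
open ExpKernelCalculus (Zl Zl_nonneg summable_exp_shift')
open LatticeConstantZl (Zl_le_elem)
open OneStepResolventKernel (Fib)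
open OneStepKernelFamily (l1_neg_eq)
open AffineAveraging (Site)
open Summit.QuantumFields.BalabanUV.Beta.HessKerDressedUnits (unitK)
open Summit.QuantumFields.BalabanUV.Beta.GAN24.CombesThomas (sfStep smStep)
open Summit.QuantumFields.BalabanUV.Beta.GAN24.CombesThomasFibre (LegOn)
open Summit.QuantumFields.BalabanUV.Beta.GAN24.CombesThomasFibreStep (l1_sub_le_coarse)
open Summit.QuantumFields.BalabanUV.Beta.GAN24.ArrowAnchorReal (aR aR_pos)
open Summit.QuantumFields.BalabanUV.Beta.GAN24.StripLegUnits (lc_pos)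
open Summit.QuantumFields.BalabanUV.Beta.GAN24.FibreStripJM (kFibΔM kFibΔM_eq_repZ unitK_KTot_eq_offset)
open Summit.QuantumFields.BalabanUV.Beta.GAN24.RealRateKMHolds (tendsto_KTot_KPerf_holds)
open Summit.QuantumFields.BalabanUV.Beta.FP.PerfectObjects (KTot)
open Summit.QuantumFields.BalabanUV.Beta.FP.PerfectObjectsT (KPerf)
open Summit.QuantumFields.BalabanUV.Beta.FP.TransportInfinityM (colOf colOf_apply)
open Summit.QuantumFields.BalabanUV.Beta.FP.PerfectColumnMassFibre (stripRegular_fm_uniform_box)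

namespace Summit.QuantumFields.BalabanUV.Beta.FP.PerfectColumnMass

/-! ## §1 The ε-trick: a joint strip bound of a finite family gives a joint bound of the lattice kernels -/

section Epsilon

variable {d : ℕ}

/-- [folklore] A finite combination `Σ_i c_i·f_i` of strip-regular multipliers is strip regular with ANY joint bound `B` of its values on the strip. -/
theorem stripRegular_sum_mul {ι : Type*} (s : Finset ι) (c : ι → ℂ) (f : ι → (Fin (d + 1) → ℂ) → ℂ) {κ : ℝ} {M : ι → ℝ} {B : ℝ}
    (hreg : ∀ i ∈ s, StripRegular (f i) κ (M i)) (hB : ∀ p ∈ Strip (d + 1) κ, ‖∑ i ∈ s, c i * f i p‖ ≤ B) :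
    StripRegular (fun p => ∑ i ∈ s, c i * f i p) κ B := by
  refine ⟨?_, ?_, ?_, hB⟩
  · exact continuousOn_finsetSum s fun i hi => continuousOn_const.mul (hreg i hi).cont
  · intro k q hq
    exact DifferentiableOn.fun_sum (u := s) (A := fun i z => c i * f i (k.insertNth z (ofRealVec q)))
      fun i hi => (differentiableOn_const (c i)).mul ((hreg i hi).diff k q hq)
  · intro k q hq y hy
    exact Finset.sum_congr rfl fun i hi => by rw [(hreg i hi).sides k q hq y hy]

/-- [folklore] **THE ε-TRICK**: if each `f_i` is strip regular on `Strip (d+1) κ` (`κ ≥ 0`) and JOINTLY `Σ_{i∈s} ‖f_i p‖ ≤ B` there, then for every lattice point `X`,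
`Σ_{i∈s} ‖latticeKernel (f_i) X‖ ≤ B·e^{−κ|X|∞}` — pv17's `latticeKernel_decay` applied to `Σ_i ε_i f_i` with the unimodular `ε_i = conj K_i(X)∕|K_i(X)|` chosen AFTER `X`
(no `ℓ²` Paley–Wiener, no Parseval over the Brillouin zone). -/
theorem sum_norm_latticeKernel_le {ι : Type*} (s : Finset ι) (f : ι → (Fin (d + 1) → ℂ) → ℂ) {κ B : ℝ} (hκ : 0 ≤ κ) {M : ι → ℝ}
    (hreg : ∀ i ∈ s, StripRegular (f i) κ (M i)) (hB : ∀ p ∈ Strip (d + 1) κ, ∑ i ∈ s, ‖f i p‖ ≤ B) (X : Fin (d + 1) → ℤ) :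
    ∑ i ∈ s, ‖latticeKernel (f i) X‖ ≤ B * Real.exp (-(κ * supNorm X)) := by
  classical
  set ε : ι → ℂ := fun i => conj (latticeKernel (f i) X) / (‖latticeKernel (f i) X‖ : ℂ) with hε
  have hε1 : ∀ i, ‖ε i‖ ≤ 1 := by
    intro i
    simp only [hε, norm_div, Complex.norm_conj, Complex.norm_real, Real.norm_eq_abs, abs_norm]
    exact div_self_le_one _
  have hεK : ∀ i, ε i * latticeKernel (f i) X = (‖latticeKernel (f i) X‖ : ℂ) := by
    intro i
    by_cases h0 : latticeKernel (f i) X = 0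
    · simp [hε, h0]
    · have hn : (‖latticeKernel (f i) X‖ : ℂ) ≠ 0 := by
        rw [Ne, Complex.ofReal_eq_zero, norm_eq_zero]; exact h0
      rw [hε, div_mul_eq_mul_div, Complex.conj_mul', sq, mul_div_assoc, div_self hn, mul_one]
  have hG : StripRegular (fun p => ∑ i ∈ s, ε i * f i p) κ B := by
    refine stripRegular_sum_mul s ε f hreg fun p hp => (norm_sum_le _ _).trans ((Finset.sum_le_sum fun i _ => ?_).trans (hB p hp))
    rw [norm_mul]
    exact (mul_le_mul_of_nonneg_right (hε1 i) (norm_nonneg _)).trans (by rw [one_mul])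
  have hlin : latticeKernel (fun p => ∑ i ∈ s, ε i * f i p) X = ∑ i ∈ s, ε i * latticeKernel (f i) X :=
    latticeKernel_sum_mul s ε f X fun i hi => (hreg i hi).integrableOn hκ X
  have hdec := latticeKernel_decay hG hκ X
  rw [hlin] at hdec
  have hsum : (∑ i ∈ s, ε i * latticeKernel (f i) X) = ((∑ i ∈ s, ‖latticeKernel (f i) X‖ : ℝ) : ℂ) := by
    push_cast
    exact Finset.sum_congr rfl fun i _ => hεK i
  rw [hsum, Complex.norm_real, Real.norm_eq_abs, abs_of_nonneg (Finset.sum_nonneg fun i _ => norm_nonneg _)] at hdec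
  exact hdec

end Epsilon

/-! ## §2 The box-summed column of the (j, m)-resolvent at a coarse offset -/

section Column

variable {Lc : ℕ} [NeZero Lc]

/-- [folklore] The coarse block index of a box point: `quo (Lc^m) (repZ zx + Lc^m • X) = X`. -/
theorem quo_box (m : ℕ) (zx : TorusSite (3 + 1) (Lc ^ m)) (X : Site (3 + 1)) :
    quo (Lc ^ m) (repZ zx + ((Lc ^ m : ℕ) : ℤ) • X) = X := by
  rw [quo_add_zsmul, quo_repZ, zero_add]

/-- [folklore] The residue of a box point: `proj (Lc^m) (repZ zx + Lc^m • X) = zx`. -/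
theorem proj_box (m : ℕ) (zx : TorusSite (3 + 1) (Lc ^ m)) (X : Site (3 + 1)) :
    Torus.proj (Lc ^ m) (repZ zx + ((Lc ^ m : ℕ) : ℤ) • X) = zx := by
  rw [proj_add_zsmul, proj_repZ]

/-- [folklore] THE BOX DECOMPOSITION IS INJECTIVE: `(zx, X) ↦ repZ zx + Lc^m • X` is one-to-one. -/
theorem box_injective (m : ℕ) :
    Function.Injective (fun zX : TorusSite (3 + 1) (Lc ^ m) × Site (3 + 1) => repZ zX.1 + ((Lc ^ m : ℕ) : ℤ) • zX.2) := by
  rintro ⟨z, X⟩ ⟨z', X'⟩ h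
  have hz : z = z' := by
    have := congrArg (Torus.proj (Lc ^ m)) h
    simpa only [proj_box] using this
  have hX : X = X' := by
    have := congrArg (quo (Lc ^ m)) h
    simpa only [quo_box] using this
  rw [hz, hX]

/-- **THE BOX-SUMMED COLUMN OF THE (j, m)-RESOLVENT DECAYS WITH AMPLITUDE `C_m`** [our object] (`d = 3`, every `Lc ≥ 1`): with the `κ` and `C_m = (5 + 2·aR 4)·e^{4κ}·5400·(Lc^m)⁻¹` of
`PerfectColumnMassFibre.stripRegular_fm_uniform_box`, for every `m j`, coarse offset `X`, fine source point `y′` and components `κ′ l`: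
`Σ_{zx ∈ (ℤ∕Lc^m)⁴} |unitK (sfStep Lc j) (smStep 3 Lc j) (KTot (Lc^(j+m)) (Lc^j)) (repZ zx + Lc^m•X) y′ (inl κ′) (inr l)| ≤ C_m · exp(−κ·|X − quo (Lc^m) y′|∞)`
(`FibreStripJM.unitK_KTot_eq_offset` + `kFibΔM_eq_repZ` + the ε-trick of §1). -/
theorem sum_box_abs_unitK_KTot_le : ∃ κ : ℝ, 0 < κ ∧ κ ≤ 1 / 4 ∧
    ∀ (m j : ℕ) (X y' : Site (3 + 1)) (κ' l : Fin (3 + 1)),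
      ∑ zx : TorusSite (3 + 1) (Lc ^ m),
          |unitK (sfStep Lc j) (smStep 3 Lc j) (KTot (d := 3) (Lc ^ (j + m)) (Lc ^ j)) (repZ zx + ((Lc ^ m : ℕ) : ℤ) • X) y' (Sum.inl κ') (Sum.inr l)| ≤
        ((5 + 2 * aR 4) * Real.exp (κ * 4) * 5400 * ((Lc : ℝ) ^ m)⁻¹) * Real.exp (-(κ * supNorm (X - quo (Lc ^ m) y'))) := by
  obtain ⟨κ, hκ, hκ4, h⟩ := stripRegular_fm_uniform_box (Lc := Lc)
  refine ⟨κ, hκ, hκ4, fun m j X y' κ' l => ?_⟩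
  obtain ⟨hreg, hjoint⟩ := h m j (Torus.proj (Lc ^ m) y') κ' l
  have hker := sum_norm_latticeKernel_le (Finset.univ : Finset (TorusSite (3 + 1) (Lc ^ m)))
    (fun zx => kFibΔM Lc (sfStep Lc) (smStep 3 Lc) m j (Sum.inl κ') (repZ zx) (Sum.inr l) (repZ (Torus.proj (Lc ^ m) y'))) hκ.le
    (fun zx _ => hreg zx) (fun p hp => hjoint p hp) (X - quo (Lc ^ m) y')
  refine le_trans (Finset.sum_le_sum fun zx _ => ?_) hker
  rw [unitK_KTot_eq_offset]
  split_ifs with hc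
  · rw [quo_box, kFibΔM_eq_repZ, proj_box]
    exact Complex.abs_re_le_norm _
  · rw [abs_zero]; exact norm_nonneg _

end Column

/-! ## §3 The weighted `ℓ¹` mass of the (j, m)-columns on every finite set of fine points, `j`-uniformly -/

section Mass

variable {Lc : ℕ} [NeZero Lc]

/-- [our object] THE DISPLAYED MASS CONSTANT `cMass κ = (5 + 2·aR 4)·e^{4κ}·5400 · e^{κ}·(1 + 16∕κ)⁴` (fibre amplitude × box slack `e^{8·(κ∕8)}` × lattice constant `Zl 4 (κ∕8)`). -/
def cMass (κ : ℝ) : ℝ := (5 + 2 * aR 4) * Real.exp (κ * 4) * 5400 * (Real.exp κ * (1 + 16 / κ) ^ 4)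

/-- [folklore] `0 ≤ cMass κ` for `κ > 0`. -/
theorem cMass_nonneg {κ : ℝ} (hκ : 0 < κ) : 0 ≤ cMass κ := by
  have haR : 0 ≤ aR 4 := le_of_lt (aR_pos 4)
  unfold cMass; positivity

/-- [folklore] THE BOX SLACK OF THE WEIGHT: `exp((κ∕8)·|x′ − y′|₁∕Lc^m) ≤ e^{κ}·exp((κ∕8)·|quo x′ − quo y′|₁)` (`l1_sub_le_coarse`: `|x′−y′|₁ ≤ Lc^m·|quo x′ − quo y′|₁ + 8·Lc^m`). -/
theorem weight_le_coarse {κ : ℝ} (hκ : 0 ≤ κ) (m : ℕ) (x' y' : Site (3 + 1)) :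
    Real.exp (κ / 8 * (l1 (x' - y') / (Lc : ℝ) ^ m)) ≤ Real.exp κ * Real.exp (κ / 8 * l1 (quo (Lc ^ m) x' - quo (Lc ^ m) y')) := by
  have hL : (0 : ℝ) < (Lc : ℝ) ^ m := pow_pos lc_pos m
  have h := l1_sub_le_coarse (Lc := Lc ^ m) x' y'
  rw [Nat.cast_pow] at h
  have h' : l1 (x' - y') ≤ (Lc : ℝ) ^ m * l1 (quo (Lc ^ m) x' - quo (Lc ^ m) y') + 8 * (Lc : ℝ) ^ m := by
    have := h; push_cast at this; linarith
  rw [← Real.exp_add]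
  refine Real.exp_le_exp.2 ?_
  have h1 : l1 (x' - y') / (Lc : ℝ) ^ m ≤ l1 (quo (Lc ^ m) x' - quo (Lc ^ m) y') + 8 := by
    rw [div_le_iff₀ hL]
    linarith
  have h2 := mul_le_mul_of_nonneg_left h1 (by positivity : (0 : ℝ) ≤ κ / 8)
  linarith

/-- **THE WEIGHTED BOX-SUMMED COLUMN AT A COARSE OFFSET** [our object]: with `δ = κ∕8`, for every `m j X y′ κ′ l`,
`Σ_{zx} exp(δ·|x′ − y′|₁∕Lc^m)·|unitK … x′ y′ (inl κ′) (inr l)| ≤ C_m·e^{κ}·exp(−δ·|X − quo y′|₁)` at `x′ = repZ zx + Lc^m•X`. -/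
theorem sum_box_weight_abs_unitK_KTot_le : ∃ κ : ℝ, 0 < κ ∧ κ ≤ 1 / 4 ∧
    ∀ (m j : ℕ) (X y' : Site (3 + 1)) (κ' l : Fin (3 + 1)),
      ∑ zx : TorusSite (3 + 1) (Lc ^ m),
          Real.exp (κ / 8 * (l1 (repZ zx + ((Lc ^ m : ℕ) : ℤ) • X - y') / (Lc : ℝ) ^ m)) *
            |unitK (sfStep Lc j) (smStep 3 Lc j) (KTot (d := 3) (Lc ^ (j + m)) (Lc ^ j)) (repZ zx + ((Lc ^ m : ℕ) : ℤ) • X) y' (Sum.inl κ') (Sum.inr l)| ≤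
        ((5 + 2 * aR 4) * Real.exp (κ * 4) * 5400 * ((Lc : ℝ) ^ m)⁻¹) * Real.exp κ * Real.exp (-(κ / 8) * l1 (X - quo (Lc ^ m) y')) := by
  obtain ⟨κ, hκ, hκ4, h⟩ := sum_box_abs_unitK_KTot_le (Lc := Lc)
  refine ⟨κ, hκ, hκ4, fun m j X y' κ' l => ?_⟩
  have haR : 0 ≤ aR 4 := le_of_lt (aR_pos 4)
  set C : ℝ := (5 + 2 * aR 4) * Real.exp (κ * 4) * 5400 * ((Lc : ℝ) ^ m)⁻¹ with hC
  have hC0 : 0 ≤ C := by positivity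
  set Y := quo (Lc ^ m) y' with hY
  -- the common weight bound on the box over `X`
  have hw : ∀ zx : TorusSite (3 + 1) (Lc ^ m),
      Real.exp (κ / 8 * (l1 (repZ zx + ((Lc ^ m : ℕ) : ℤ) • X - y') / (Lc : ℝ) ^ m)) ≤ Real.exp κ * Real.exp (κ / 8 * l1 (X - Y)) := by
    intro zx
    have := weight_le_coarse (Lc := Lc) hκ.le m (repZ zx + ((Lc ^ m : ℕ) : ℤ) • X) y'
    rwa [quo_box] at this
  have hsup : Real.exp (-(κ * supNorm (X - Y))) ≤ Real.exp (-(κ / (3 + 1)) * l1 (X - Y)) := by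
    have := exp_supNorm_le_exp_l1 (d := 3) hκ.le (X - Y)
    simpa [l1] using this
  calc ∑ zx : TorusSite (3 + 1) (Lc ^ m), Real.exp (κ / 8 * (l1 (repZ zx + ((Lc ^ m : ℕ) : ℤ) • X - y') / (Lc : ℝ) ^ m)) *
          |unitK (sfStep Lc j) (smStep 3 Lc j) (KTot (d := 3) (Lc ^ (j + m)) (Lc ^ j)) (repZ zx + ((Lc ^ m : ℕ) : ℤ) • X) y' (Sum.inl κ') (Sum.inr l)|
      ≤ ∑ zx : TorusSite (3 + 1) (Lc ^ m), (Real.exp κ * Real.exp (κ / 8 * l1 (X - Y))) *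
          |unitK (sfStep Lc j) (smStep 3 Lc j) (KTot (d := 3) (Lc ^ (j + m)) (Lc ^ j)) (repZ zx + ((Lc ^ m : ℕ) : ℤ) • X) y' (Sum.inl κ') (Sum.inr l)| :=
        Finset.sum_le_sum fun zx _ => mul_le_mul_of_nonneg_right (hw zx) (abs_nonneg _)
    _ = (Real.exp κ * Real.exp (κ / 8 * l1 (X - Y))) * ∑ zx : TorusSite (3 + 1) (Lc ^ m),
          |unitK (sfStep Lc j) (smStep 3 Lc j) (KTot (d := 3) (Lc ^ (j + m)) (Lc ^ j)) (repZ zx + ((Lc ^ m : ℕ) : ℤ) • X) y' (Sum.inl κ') (Sum.inr l)| := by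
        rw [Finset.mul_sum]
    _ ≤ (Real.exp κ * Real.exp (κ / 8 * l1 (X - Y))) * (C * Real.exp (-(κ * supNorm (X - Y)))) :=
        mul_le_mul_of_nonneg_left (h m j X y' κ' l) (by positivity)
    _ ≤ (Real.exp κ * Real.exp (κ / 8 * l1 (X - Y))) * (C * Real.exp (-(κ / (3 + 1)) * l1 (X - Y))) :=
        mul_le_mul_of_nonneg_left (mul_le_mul_of_nonneg_left hsup hC0) (by positivity)
    _ = C * Real.exp κ * Real.exp (-(κ / 8) * l1 (X - Y)) := by
        have : Real.exp (κ / 8 * l1 (X - Y)) * Real.exp (-(κ / (3 + 1)) * l1 (X - Y)) = Real.exp (-(κ / 8) * l1 (X - Y)) := by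
          rw [← Real.exp_add]; congr 1; ring
        calc (Real.exp κ * Real.exp (κ / 8 * l1 (X - Y))) * (C * Real.exp (-(κ / (3 + 1)) * l1 (X - Y)))
            = C * Real.exp κ * (Real.exp (κ / 8 * l1 (X - Y)) * Real.exp (-(κ / (3 + 1)) * l1 (X - Y))) := by ring
          _ = _ := by rw [this]

/-- [folklore] A finite partial sum of the shifted lattice exponential is at most the lattice constant: `Σ_{X ∈ F} e^{−c|X − Y|₁} ≤ Zl 4 c ≤ (1 + 2∕c)⁴`. -/
theorem sum_exp_le_Zl {c : ℝ} (hc : 0 < c) (F : Finset (Site (3 + 1))) (Y : Site (3 + 1)) :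
    ∑ X ∈ F, Real.exp (-c * l1 (X - Y)) ≤ (1 + 2 / c) ^ (3 + 1) := by
  have hs := summable_exp_shift' (D := 3 + 1) hc Y
  have h1 : ∑ X ∈ F, Real.exp (-c * l1 (X - Y)) ≤ ∑' X : Site (3 + 1), Real.exp (-c * l1 (X - Y)) :=
    hs.sum_le_tsum F fun X _ => (Real.exp_pos _).le
  have h2 : ∑' X : Site (3 + 1), Real.exp (-c * l1 (X - Y)) = Zl (3 + 1) c := by
    unfold Zl
    exact ((Equiv.subRight Y).tsum_eq fun X : Site (3 + 1) => Real.exp (-c * l1 X))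
  rw [h2] at h1
  exact h1.trans (Zl_le_elem hc (3 + 1))

/-- **THE WEIGHTED `ℓ¹` MASS OF THE (j, m)-COLUMNS ON EVERY FINITE SET, `j`-UNIFORMLY** [our object] (`d = 3`, every `Lc ≥ 1`): there is `κ ∈ (0, 1∕4]` such that for ALL `m j y′ κ′ l`
and EVERY finite set `S` of fine points,
`Σ_{x′ ∈ S} exp((κ∕8)·|x′ − y′|₁∕Lc^m)·|unitK (sfStep Lc j) (smStep 3 Lc j) (KTot (Lc^(j+m)) (Lc^j)) x′ y′ (inl κ′) (inr l)| ≤ cMass κ·((Lc:ℝ)^m)⁻¹` (box decomposition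
`x′ = repZ (proj x′) + Lc^m • quo x′`, §2 per coarse offset, `Zl 4 (κ∕8) ≤ (1 + 16∕κ)⁴`). -/
theorem sum_weight_abs_unitK_KTot_le : ∃ κ : ℝ, 0 < κ ∧ κ ≤ 1 / 4 ∧
    ∀ (m j : ℕ) (y' : Site (3 + 1)) (κ' l : Fin (3 + 1)) (S : Finset (Site (3 + 1))),
      ∑ x' ∈ S, Real.exp (κ / 8 * (l1 (x' - y') / (Lc : ℝ) ^ m)) *
          |unitK (sfStep Lc j) (smStep 3 Lc j) (KTot (d := 3) (Lc ^ (j + m)) (Lc ^ j)) x' y' (Sum.inl κ') (Sum.inr l)| ≤ cMass κ * ((Lc : ℝ) ^ m)⁻¹ := by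
  classical
  obtain ⟨κ, hκ, hκ4, h⟩ := sum_box_weight_abs_unitK_KTot_le (Lc := Lc)
  refine ⟨κ, hκ, hκ4, fun m j y' κ' l S => ?_⟩
  have haR : 0 ≤ aR 4 := le_of_lt (aR_pos 4)
  set L : ℕ := Lc ^ m with hLdef
  set g : Site (3 + 1) → ℝ := fun x' => Real.exp (κ / 8 * (l1 (x' - y') / (Lc : ℝ) ^ m)) *
    |unitK (sfStep Lc j) (smStep 3 Lc j) (KTot (d := 3) (Lc ^ (j + m)) (Lc ^ j)) x' y' (Sum.inl κ') (Sum.inr l)| with hg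
  have hg0 : ∀ x', 0 ≤ g x' := fun x' => mul_nonneg (Real.exp_pos _).le (abs_nonneg _)
  set φ : TorusSite (3 + 1) L × Site (3 + 1) → Site (3 + 1) := fun zX => repZ zX.1 + ((L : ℕ) : ℤ) • zX.2 with hφ
  set F : Finset (Site (3 + 1)) := S.image (quo L) with hF
  -- the box decomposition covers `S`
  have hcover : S ⊆ (Finset.univ ×ˢ F).image φ := by
    intro x' hx'
    rw [Finset.mem_image]
    refine ⟨(Torus.proj L x', quo L x'), Finset.mem_product.2 ⟨Finset.mem_univ _, Finset.mem_image_of_mem _ hx'⟩, ?_⟩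
    exact (eq_repZ_add_zsmul_quo (N := L) x').symm
  have hinj : Set.InjOn φ ↑((Finset.univ : Finset (TorusSite (3 + 1) L)) ×ˢ F) := fun a _ b _ hab => box_injective (Lc := Lc) m hab
  calc ∑ x' ∈ S, g x' ≤ ∑ x' ∈ (Finset.univ ×ˢ F).image φ, g x' := Finset.sum_le_sum_of_subset_of_nonneg hcover fun x _ _ => hg0 x
    _ = ∑ zX ∈ Finset.univ ×ˢ F, g (φ zX) := Finset.sum_image hinj
    _ = ∑ X ∈ F, ∑ zx : TorusSite (3 + 1) L, g (φ (zx, X)) := by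
        rw [Finset.sum_product_right]
    _ ≤ ∑ X ∈ F, ((5 + 2 * aR 4) * Real.exp (κ * 4) * 5400 * ((Lc : ℝ) ^ m)⁻¹) * Real.exp κ * Real.exp (-(κ / 8) * l1 (X - quo L y')) :=
        Finset.sum_le_sum fun X _ => h m j X y' κ' l
    _ = ((5 + 2 * aR 4) * Real.exp (κ * 4) * 5400 * ((Lc : ℝ) ^ m)⁻¹) * Real.exp κ * ∑ X ∈ F, Real.exp (-(κ / 8) * l1 (X - quo L y')) := by
        rw [Finset.mul_sum]
    _ ≤ ((5 + 2 * aR 4) * Real.exp (κ * 4) * 5400 * ((Lc : ℝ) ^ m)⁻¹) * Real.exp κ * (1 + 2 / (κ / 8)) ^ (3 + 1) :=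
        mul_le_mul_of_nonneg_left (sum_exp_le_Zl (by positivity) F _) (by positivity)
    _ = cMass κ * ((Lc : ℝ) ^ m)⁻¹ := by
        unfold cMass
        have : (1 + 2 / (κ / 8)) = 1 + 16 / κ := by field_simp; ring
        rw [this]
        ring

end Mass

/-! ## §4 The perfect `m`-fold resolvent (`2 ≤ Lc`, `m ≥ 1`): finite sets, summability, `tsum` -/

section Perfect

variable {Lc : ℕ} [NeZero Lc]

/-- [folklore] Nonnegative families with uniformly bounded finite partial sums are summable with `tsum ≤` the bound. -/
theorem summable_and_tsum_le_of_sum_le {ι : Type*} {g : ι → ℝ} {B : ℝ} (hg : ∀ i, 0 ≤ g i) (h : ∀ S : Finset ι, ∑ i ∈ S, g i ≤ B) :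
    Summable g ∧ ∑' i, g i ≤ B :=
  ⟨summable_of_sum_le hg h, Real.tsum_le_of_sum_le hg h⟩

/-- **THE WEIGHTED `ℓ¹` MASS OF THE PERFECT `m`-FOLD RESOLVENT'S COLUMN QUARTER ON EVERY FINITE SET** [our object] (`d = 3`, `2 ≤ Lc`): the `j → ∞` limit of §3 on finite sets
(`RealRateKMHolds.tendsto_KTot_KPerf_holds`, `tendsto_finset_sum`, `le_of_tendsto'`). -/
theorem sum_weight_abs_KPerf_le (hLc : 2 ≤ Lc) : ∃ κ : ℝ, 0 < κ ∧ κ ≤ 1 / 4 ∧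
    ∀ m, 1 ≤ m → ∀ (y' : Site (3 + 1)) (κ' l : Fin (3 + 1)) (S : Finset (Site (3 + 1))),
      ∑ x' ∈ S, Real.exp (κ / 8 * (l1 (x' - y') / (Lc : ℝ) ^ m)) * |KPerf (d := 3) Lc (sfStep Lc) (smStep 3 Lc) m x' y' (Sum.inl κ') (Sum.inr l)| ≤
        cMass κ * ((Lc : ℝ) ^ m)⁻¹ := by
  obtain ⟨κ, hκ, hκ4, h⟩ := sum_weight_abs_unitK_KTot_le (Lc := Lc)
  refine ⟨κ, hκ, hκ4, fun m hm y' κ' l S => ?_⟩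
  have hlim : Tendsto (fun j => ∑ x' ∈ S, Real.exp (κ / 8 * (l1 (x' - y') / (Lc : ℝ) ^ m)) *
      |unitK (sfStep Lc j) (smStep 3 Lc j) (KTot (d := 3) (Lc ^ (j + m)) (Lc ^ j)) x' y' (Sum.inl κ') (Sum.inr l)|) atTop
      (𝓝 (∑ x' ∈ S, Real.exp (κ / 8 * (l1 (x' - y') / (Lc : ℝ) ^ m)) * |KPerf (d := 3) Lc (sfStep Lc) (smStep 3 Lc) m x' y' (Sum.inl κ') (Sum.inr l)|)) :=
    tendsto_finsetSum S fun x' _ => ((tendsto_KTot_KPerf_holds hLc hm x' y' (Sum.inl κ') (Sum.inr l)).abs).const_mul _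
  exact le_of_tendsto' hlim fun j => h m j y' κ' l S

/-- **THE PERFECT COLUMN QUARTER IS WEIGHTED-`ℓ¹` SUMMABLE WITH MASS `O(1∕Lc^m)`** [our object] (`d = 3`, `2 ≤ Lc`): for every `m ≥ 1`, `y′`, `κ′`, `l`, the family
`x′ ↦ exp((κ∕8)·|x′ − y′|₁∕Lc^m)·|KPerf … m x′ y′ (inl κ′) (inr l)|` is summable and its sum is `≤ cMass κ·((Lc:ℝ)^m)⁻¹`. -/
theorem tsum_weight_abs_KPerf_le (hLc : 2 ≤ Lc) : ∃ κ : ℝ, 0 < κ ∧ κ ≤ 1 / 4 ∧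
    ∀ m, 1 ≤ m → ∀ (y' : Site (3 + 1)) (κ' l : Fin (3 + 1)),
      Summable (fun x' : Site (3 + 1) => Real.exp (κ / 8 * (l1 (x' - y') / (Lc : ℝ) ^ m)) *
          |KPerf (d := 3) Lc (sfStep Lc) (smStep 3 Lc) m x' y' (Sum.inl κ') (Sum.inr l)|) ∧
      ∑' x' : Site (3 + 1), Real.exp (κ / 8 * (l1 (x' - y') / (Lc : ℝ) ^ m)) * |KPerf (d := 3) Lc (sfStep Lc) (smStep 3 Lc) m x' y' (Sum.inl κ') (Sum.inr l)| ≤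
        cMass κ * ((Lc : ℝ) ^ m)⁻¹ := by
  obtain ⟨κ, hκ, hκ4, h⟩ := sum_weight_abs_KPerf_le (Lc := Lc) hLc
  refine ⟨κ, hκ, hκ4, fun m hm y' κ' l => ?_⟩
  exact summable_and_tsum_le_of_sum_le (fun x' => mul_nonneg (Real.exp_pos _).le (abs_nonneg _)) fun S => h m hm y' κ' l S

end Perfect

/-! ## §5 The perfect minimiser column: the row's letters in ℓ¹ form -/

section Letters

variable {Lc : ℕ} [NeZero Lc]

/-- **ROW IPROF-UNIF, ROUTE (γ): THE EXPONENTIALLY WEIGHTED `ℓ¹` MASS OF THE PERFECT MINIMISER COLUMN IS `O(1∕Lc^m)`** [our object] (`d = 3`, `2 ≤ Lc`): there is `κ ∈ (0, 1∕4]`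
such that for every `m ≥ 1` and all `κ′ l`, the family `x ↦ exp((κ∕8)·|x|₁∕Lc^m)·|colOf (KPerf Lc (sfStep Lc) (smStep 3 Lc) m) κ′ l x|` is summable and
`Σ'_x exp((κ∕8)·|x|₁∕Lc^m)·|colOf (KPerf … m) κ′ l x| ≤ cMass κ·((Lc:ℝ)^m)⁻¹` — `cMass κ = (5 + 2·aR 4)·e^{4κ}·5400·e^{κ}·(1 + 16∕κ)⁴`, `m`-FREE.  («p = 5 in ℓ¹-mean»; the sup-norm
power of the row's literal wording is NOT claimed.) -/
theorem tsum_weight_abs_colOf_KPerf_le (hLc : 2 ≤ Lc) : ∃ κ : ℝ, 0 < κ ∧ κ ≤ 1 / 4 ∧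
    ∀ m, 1 ≤ m → ∀ (κ' l : Fin 4),
      Summable (fun x : Fin 4 → ℤ => Real.exp (κ / 8 * (l1 x / (Lc : ℝ) ^ m)) * |colOf (KPerf (d := 3) Lc (sfStep Lc) (smStep 3 Lc) m) κ' l x|) ∧
      ∑' x : Fin 4 → ℤ, Real.exp (κ / 8 * (l1 x / (Lc : ℝ) ^ m)) * |colOf (KPerf (d := 3) Lc (sfStep Lc) (smStep 3 Lc) m) κ' l x| ≤ cMass κ * ((Lc : ℝ) ^ m)⁻¹ := by
  classical
  obtain ⟨κ, hκ, hκ4, h⟩ := sum_weight_abs_KPerf_le (Lc := Lc) hLc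
  refine ⟨κ, hκ, hκ4, fun m hm κ' l => ?_⟩
  refine summable_and_tsum_le_of_sum_le (fun x => mul_nonneg (Real.exp_pos _).le (abs_nonneg _)) fun S => ?_
  -- reflect the finite set and read the column at `y′ = 0`
  have hneg : Set.InjOn (fun x : Fin 4 → ℤ => -x) ↑S := fun a _ b _ hab => neg_injective hab
  have hS := h m hm 0 κ' l (S.image fun x => -x)
  rw [Finset.sum_image hneg] at hS
  refine le_trans (le_of_eq (Finset.sum_congr rfl fun x _ => ?_)) hS
  rw [colOf_apply, sub_zero, l1_neg_eq]

/-- **ROW IPROF-UNIF IN THE CONSUMER'S CURRENCY** [our object] (`d = 3`, `2 ≤ Lc`): the hypotheses `hwE`∕`hwEb` of the H3-BOOK (b-T) letters interface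
`FP/HorizontalBookkeepingTailLetters.summable_weight_transport_tail_sub_of_expL1` (d1-formalise-leaf-02 g6), AT `N := Lc^m`, `w := colOf (KPerf Lc (sfStep Lc) (smStep 3 Lc) m)`,
for EVERY `m ≥ 1` with ONE pair `(δ, c) = (κ∕8, cMass κ)`: `Summable (x ↦ e^{(δ∕N)|x|₁}·|w κ′ l x|)` and `Σ'_x e^{(δ∕N)|x|₁}·|w κ′ l x| ≤ c∕N`.  (The polynomial letters — mass `≤ ·∕N`,
`Σ'(|x|₁+1)^k|w| ≤ ·N^k∕N` — are that file's `letter_of_expL1`; nothing of them is restated here.) -/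
theorem expL1_colOf_KPerf (hLc : 2 ≤ Lc) : ∃ δ c : ℝ, 0 < δ ∧ 0 ≤ c ∧
    ∀ m, 1 ≤ m → ∀ (κ' l : Fin 4),
      Summable (fun x : Fin 4 → ℤ => Real.exp (δ / ((Lc ^ m : ℕ) : ℝ) * l1 x) * |colOf (KPerf (d := 3) Lc (sfStep Lc) (smStep 3 Lc) m) κ' l x|) ∧
      ∑' x : Fin 4 → ℤ, Real.exp (δ / ((Lc ^ m : ℕ) : ℝ) * l1 x) * |colOf (KPerf (d := 3) Lc (sfStep Lc) (smStep 3 Lc) m) κ' l x| ≤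
        c / ((Lc ^ m : ℕ) : ℝ) := by
  obtain ⟨κ, hκ, hκ4, h⟩ := tsum_weight_abs_colOf_KPerf_le (Lc := Lc) hLc
  refine ⟨κ / 8, cMass κ, by positivity, cMass_nonneg hκ, fun m hm κ' l => ?_⟩
  obtain ⟨hs, hb⟩ := h m hm κ' l
  have hfun : (fun x : Fin 4 → ℤ => Real.exp (κ / 8 / ((Lc ^ m : ℕ) : ℝ) * l1 x) * |colOf (KPerf (d := 3) Lc (sfStep Lc) (smStep 3 Lc) m) κ' l x|)
      = fun x => Real.exp (κ / 8 * (l1 x / (Lc : ℝ) ^ m)) * |colOf (KPerf (d := 3) Lc (sfStep Lc) (smStep 3 Lc) m) κ' l x| := by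
    funext x; rw [Nat.cast_pow, div_mul_eq_mul_div, mul_div_assoc]
  rw [hfun, Nat.cast_pow, div_eq_mul_inv]
  exact ⟨hs, hb⟩

end Letters

end Summit.QuantumFields.BalabanUV.Beta.FP.PerfectColumnMass

end
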